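import Literature.MathematicalPhysics.QuantumFieldTheory.Balaban1983to89.B2Eq28RegionsConcrete
import Literature.MathematicalPhysics.QuantumFieldTheory.Balaban1983to89.B2Eq255Concrete
import Literature.MathematicalPhysics.QuantumFieldTheory.Balaban1983to89.HiggsDoubleRT
import Literature.MathematicalPhysics.QuantumFieldTheory.Balaban1983to89.HiggsActionIntegrable

/-!
# `Balaban1983to89.B2Eq22LargeFieldSets` — T. Bałaban, *(Higgs)₂,₃ quantum fields in a finite volume. II. An upper bound*,
Commun. Math. Phys. **86** (1982) 555–594 [Balaban1982Higgs2] pp. 557–558, (2.2) and (2.4)–(2.6): **the large-field sets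
`P_v, Q_v, R_v, P_s, Q_s, R_s` OF A CONFIGURATION on the concrete (Higgs)₂,₃ carrier** — the six printed quantities
`|B(y) − (QA)(y)|`, `|(∂A)(b)|`, `|A(x)|`, `|ψ(y) − (Q(A)φ)(y)|`, `|(D_Aφ)(b)|`, `|φ(x)|` as functions of the concrete fields,
the sets where they exceed the thresholds of (2.2), the expansion (2.4) INSTANTIATED (r14's abstract `B2LargeField.partition24`)
with the proof that exactly ONE of its terms is non-zero at each configuration (the term of the configuration's own large-field
sets), and — feeding these sets into the typer's construction (2.7) `B2Eq28RegionsConcrete` — the p. 558 sentence *"Of course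
all the fields are small on the set Λ₀ and on the neighbourhood of Λ₀ of the additional thickness r(ε)"* PROVED AT THE LEVEL
OF THE FIELDS

statement-level skeleton of published theorems with citation tags; proofs where landed; nothing here is a claim about the Yang–Mills mass gap

PDF held: `paper:balaban1982-cmp86-higgs23-ii` (journal page = PDF page + 554); pp. 557–558 [PDF 3–4] READ AS IMAGES on the
×2 renders `run/shared/lean/pub/pub-balaban/b2b-balaban-ref1/pages/1982-cmp86-higgs23-II/1982-cmp86-higgs23-II-p003-x2.png`,
`…-p004-x2.png`.

CITATION HEADER (lean-in-tree rule).  lit-balaban typed skeleton (HOME `run/shared/lean/pub/lit-balaban/`), typer line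
(concrete carriers), gen 8; sequel of `B2Eq28RegionsConcrete` (p262717/p263008/p263448/p264514).  SKELETON rows served:
**B2.Eq2.6** ((2.4)–(2.6), fold owner r02 / second reader r14; row of record = r14's ABSTRACT `B2LargeField.partition24`,
`sum_powerset_prod_eq_one`, `indicator_add_compl`, p239284) — CONCRETE INSTANCE; **B2.Eq2.3** (the (2.2) quantities and
thresholds; the small factors (2.3) themselves are r02's `B2Sect2Statements.smallFactor23`, PROVED, not touched); **B2.Eq2.7**
(the p. 558 sentence, now for the fields).  NOTHING of record is restated or redefined: the thresholds ARE r14's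
`B2LargeField.thrA`/`thrPhi` (and its six-number predicates `LargeField`/`SmallField`), the pointwise sizes `|(∂A)(b)|`, `|A(x)|`,
`|φ(x)|` ARE the typer's `B2Eq255Concrete.dA`/`absA`/`absPhi`, `|(D_Aφ)(b)|` IS `HiggsLattice.covDeriv`, the block averages
`QA`, `Q(A)φ` ARE `HiggsAveraging.avgQ` (the vector one at `N = d`, zero charge, zero external field on the site reading
`B3MultiscaleFields.toSite`, exactly as in `HiggsDoubleRT.vecKernel`), the expansion IS `B2LargeField.partition24`, the
regions ARE `B2Eq28RegionsConcrete.region` at `badSites`.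

THE SOURCE TEXT (pp. 557–558, verbatim).  *"If any of the following inequalities holds |B(y) − (QA)(y)| > p(ε),
|(∂A)(b)| > p(ε), |A(x)| > (1/(μ₀ε))p(ε), |ψ(y) − (Q(A)φ)(y)| > p(ε), |(D_Aφ)(b)| > p(ε), |φ(x)| > (1/(λε^{4−d})^{1/4})p(ε),
(2.2) then the corresponding factor in (2.1) satisfies the inequality exp(−(…)) < exp(−c₀p(ε)²), (2.3) … Let us denote by
Λ* the set of all bonds contained in Λ … The following equality holds 1 = Σ_{P_v⊂T′₁}Σ_{Q_v⊂T*₁}Σ_{R_v⊂T₁}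
Π_{y∈P_v}χ({|B(y)−(QA)(y)| > p(ε)}) Π_{y∈P_vᶜ}χ({|B(y)−(QA)(y)| ≦ p(ε)}) Π_{b∈Q_v}χ({|(∂A)(b)| > p(ε)})
Π_{b∈Q_vᶜ}χ({|(∂A)(b)| ≦ p(ε)}) Π_{x∈R_v}χ({|A(x)| > (1/(μ₀ε))p(ε)}) Π_{x∈R_vᶜ}χ({|A(x)| ≦ (1/(μ₀ε))p(ε)})
=: Σ Σ Σ χᶜ_{P_v}χ_{P_vᶜ}χᶜ_{Q_v}χ_{Q_vᶜ}χᶜ_{R_v}χ_{R_vᶜ}. (2.4) An analogous equality for the scalar field is … (2.5) where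
λ(ε) = λε^{4−d}. Unifying these two expansions, i.e. multiplying (2.4) and (2.5), we get a joint expansion (2.6). We assign a
division of the lattice T₁ into two domains with each term in the above sum on the right side. The first one contains points
and bonds at which the fields or their derivatives are large, for the second domain they are small. … (2.7) … (2.8) Of course
all the fields are small on the set Λ₀ and on the neighbourhood of Λ₀ of the additional thickness r(ε) also."*

DICTIONARY (print ↦ Lean; level-generic: the fields of the step live on `T^{(j)}` = `HiggsLattice.Site P j`, the new fields
on `T^{(j+1)}`; the first step is `j = 0`).  `A` ↦ `A : VecField P j`, `φ` ↦ `φ : ScalarField P j N`, `B` ↦ `B : VecField P (j+1)`,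
`ψ` ↦ `ψ : ScalarField P (j+1) N`; `(QA)(y)` ↦ `avgQ (zeroCharge d) 0 (toSite A) y` (plain block average of the site reading
`x ↦ (A_μ(x))_μ`, paper I p. 608 *"N = d and an external vector field A = 0"*), `(Q(A)φ)(y)` ↦ `avgQ C ext φ y` with the
transport field `ext : VecField P 0` (= `A` at the first step; = the `Ã` of (2.45) later); `|(∂A)(b)|` ↦ `B2Eq255Concrete.dA A b`,
`|A(x)|` ↦ `absA A x`, `|(D_Aφ)(b)|` ↦ `‖covDeriv C Abg φ b‖` with the covariant-derivative field `Abg : VecField P j` (= `A` at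
the first step; = `Ā^{(k)}` in (2.55)), `|φ(x)|` ↦ `absPhi φ x`; thresholds `p` ↦ `p(ε)`, `qA` ↦ `(1/(μ₀ε))p(ε)` = r14's
`thrA μ₀ ε p`, `qφ` ↦ `p(ε)/λ(ε)^{1/4}` = r14's `thrPhi λ ε d p` (free reals in §1–§2; §3's `smallField_of_mem_near` is stated at r14's printed thresholds);
`T′₁, T*₁, T₁` ↦ `Finset.univ` of `Site P (j+1)`, `PBond P j`, `Site P j`; `χ({E})` ↦ `ind E = if E then 1 else 0`;
`P_v, …, R_s` of a configuration ↦ `setPv p B A`, `setQv p A`, `setRv qA A`, `setPs C p ext ψ φ`, `setQs C p Abg φ`, `setRs qφ φ`;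
the large-field POINTS ↦ `bad24 … = B2Eq28RegionsConcrete.badSites setPv setPs setQv setQs setRv setRs`; `Λ₀` ↦
`B2Eq28RegionsConcrete.region ↑(bad24 …) r 0`; *"the neighbourhood of Λ₀ of the additional thickness r(ε)"* ↦ `near (Λ₀) r`.

WHAT THIS FILE PROVES (0 sorry; standard axioms; definitions with bodies + theorems; no `Prop`-valued definition).
§1 the six quantities and sets, membership unfoldings.  §2 **(2.4) CONCRETE** `eq24_concrete` (the triple sum of products of
indicators over all `P_v ⊂ T′`, `Q_v ⊂ T*`, `R_v ⊂ T` equals `1`, every configuration — r14's `partition24` at the concrete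
indicators), **(2.5)** `eq25_concrete`, and the LOCATION of the non-zero term: `prod_ind_eq_ite` (generic: `Π_{S}χ(E)·Π_{Sᶜ}χ(¬E)
= [S = {E}]`), `term24_eq_ite`/`term24_self`/`term24_eq_zero` and `term25_eq_ite` (*"We assign a division of the lattice T₁ into two
domains with each term"*: the term of `(P_v,Q_v,R_v)` is `1` iff these ARE the configuration's large-field sets, else `0`).
§3 the p. 558 sentence AT FIELD LEVEL, for the regions of (2.7) built on the configuration's large-field points (every `r ≥ 0`):
on `near Λ₀ r` (hence on `Λ₀`, `r > 0`) **`absA_le_of_mem_near`** (`|A(x)| ≤ qA`), **`absPhi_le_of_mem_near`** (`|φ(x)| ≤ qφ`),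
**`dA_le_of_src_mem_near`/`_tgt_`** (`|(∂A)(b)| ≤ p` for every bond with an endpoint there), **`covDeriv_le_of_src_mem_near`/`_tgt_`**,
**`devB_le_of_mem_near`** (`|B(y) − (QA)(y)| ≤ p` for the block `y = blockOf x` of any such point), **`devPsi_le_of_mem_near`**, and
the six facts bundled as r14's `SmallField` predicate: **`smallField_of_mem_near`**.
§4 (v1.1, append-only; no v1 declaration changed; imports `HiggsDoubleRT`, `HiggsActionIntegrable` added for the continuity lemmas)
MEASURABILITY (p. 558 *"The above expansion is introduced under the integral (2.1)"*): the six quantities are continuous in the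
configuration (`continuous_devB`, `continuous_devPsi`, `continuous_dA`, `continuous_absA`, `continuous_norm_covDeriv`,
`continuous_absPhi`), the large-field events are measurable sets (Mathlib `measurableSet_lt`), and every term of (2.4)/(2.5)
is a measurable function of the configuration (**`measurable_term24`**, **`measurable_term25`**; generic `measurable_prodInd`) —
this removes item (c) of the honest scope below for the terms (the regions' dependence on the configuration is finite-valued through
the sets and is not separately stated).
HONEST SCOPE.  (a) (2.3) (the small factors) and the admissible/minimal resummation (2.9)–(2.10) are NOT here (rows B2.Eq2.3
proved by r02, B2.Eq2.9 by r14).  (b) The transport field `ext` and the covariant-derivative field `Abg` are parameters (first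
step: both `= A`, recorded as the corollary-free specialisation the user makes; later steps: (2.45)/(2.55)).  (c) No measure
theory: measurability of configuration ↦ term (needed to put (2.6) under the integral (2.1)) is not asserted here.  (d) Value =
the printed large-field bookkeeping made concrete and the p. 558 sentence as field inequalities consumable by name; NOT summit
progress.  Unit `lit-balaban-typer` gen 8 (literature-prover-lit-balaban-typer-g8-0); HOME/FILED.md records the proposal.
-/

open scoped BigOperators

namespace Literature.MathematicalPhysics.QuantumFieldTheory.Balaban1983to89.B2Eq22LargeFieldSets

open HiggsLattice HiggsAveraging B2LargeField B2Eq28RegionsConcrete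
open B3MultiscaleFields (toSite zeroCharge)
open B2Eq255Concrete (dA absA absPhi)

variable {P : HiggsLattice.Params} {N : ℕ} {j : ℕ}

/-! ## §1 The six quantities of (2.2) and the large-field sets of a configuration -/

section Quantities

/-- `|B(y) − (QA)(y)|` of (2.2): the new vector field against the plain block average of the old one (site readings,
zero charge, zero external field — paper I p. 608). [cite: Balaban1982Higgs2, (2.2) p.557] -/
noncomputable def devB (B : HiggsLattice.VecField P (j + 1)) (A : HiggsLattice.VecField P j) (y : HiggsLattice.Site P (j + 1)) : ℝ :=
  ‖toSite B y - avgQ (zeroCharge P.d) (0 : HiggsLattice.VecField P 0) (toSite A) y‖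

/-- `|ψ(y) − (Q(A)φ)(y)|` of (2.2), with the transport field `ext` of the average (2.7) of part I. [cite: Balaban1982Higgs2, (2.2) p.557] -/
noncomputable def devPsi (C : ChargeData N) (ext : HiggsLattice.VecField P 0) (ψ : ScalarField P (j + 1) N)
    (φ : ScalarField P j N) (y : HiggsLattice.Site P (j + 1)) : ℝ :=
  ‖ψ y - avgQ C ext φ y‖

/-- `χ({E})`: the indicator of an event as a real number. [cite: Balaban1982Higgs2, (2.4) p.557] -/
noncomputable def ind (E : Prop) [Decidable E] : ℝ := if E then 1 else 0

/-- `χ({E}) + χ({¬E}) = 1`. [cite: Balaban1982Higgs2, (2.4) p.557] -/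
theorem ind_add_ind_not (E : Prop) [Decidable E] : ind E + ind (¬E) = 1 := by
  unfold ind
  split_ifs <;> norm_num

/-- `χ({E}) = 1` when `E` holds. [cite: Balaban1982Higgs2, (2.4) p.557] -/
theorem ind_of_pos {E : Prop} [Decidable E] (h : E) : ind E = 1 := by
  unfold ind; rw [if_pos h]

/-- `χ({E}) = 0` when `E` fails. [cite: Balaban1982Higgs2, (2.4) p.557] -/
theorem ind_of_neg {E : Prop} [Decidable E] (h : ¬E) : ind E = 0 := by
  unfold ind; rw [if_neg h]

open Classical in
/-- **`P_v`** of a configuration: the blocks `y ∈ T′` with `|B(y) − (QA)(y)| > p(ε)`. [cite: Balaban1982Higgs2, (2.4) p.557] -/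
noncomputable def setPv (p : ℝ) (B : HiggsLattice.VecField P (j + 1)) (A : HiggsLattice.VecField P j) :
    Finset (HiggsLattice.Site P (j + 1)) :=
  Finset.univ.filter fun y => p < devB B A y

open Classical in
/-- **`Q_v`** of a configuration: the bonds `b ∈ T*` with `|(∂A)(b)| > p(ε)`. [cite: Balaban1982Higgs2, (2.4) p.557] -/
noncomputable def setQv (p : ℝ) (A : HiggsLattice.VecField P j) : Finset (HiggsLattice.PBond P j) :=
  Finset.univ.filter fun b => p < dA A b

open Classical in
/-- **`R_v`** of a configuration: the points `x ∈ T` with `|A(x)| > (1/(μ₀ε))p(ε)` (threshold `qA`). [cite: Balaban1982Higgs2, (2.4) p.557] -/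
noncomputable def setRv (qA : ℝ) (A : HiggsLattice.VecField P j) : Finset (HiggsLattice.Site P j) :=
  Finset.univ.filter fun x => qA < absA A x

open Classical in
/-- **`P_s`** of a configuration: the blocks `y` with `|ψ(y) − (Q(A)φ)(y)| > p(ε)`. [cite: Balaban1982Higgs2, (2.5) p.557] -/
noncomputable def setPs (C : ChargeData N) (p : ℝ) (ext : HiggsLattice.VecField P 0) (ψ : ScalarField P (j + 1) N)
    (φ : ScalarField P j N) : Finset (HiggsLattice.Site P (j + 1)) :=
  Finset.univ.filter fun y => p < devPsi C ext ψ φ y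

open Classical in
/-- **`Q_s`** of a configuration: the bonds `b` with `|(D_Aφ)(b)| > p(ε)` (covariant-derivative field `Abg`).
[cite: Balaban1982Higgs2, (2.5) p.557] -/
noncomputable def setQs (C : ChargeData N) (p : ℝ) (Abg : HiggsLattice.VecField P j) (φ : ScalarField P j N) :
    Finset (HiggsLattice.PBond P j) :=
  Finset.univ.filter fun b => p < ‖covDeriv C Abg φ b‖

open Classical in
/-- **`R_s`** of a configuration: the points `x` with `|φ(x)| > p(ε)/λ(ε)^{1/4}` (threshold `qφ`). [cite: Balaban1982Higgs2, (2.5) p.557] -/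
noncomputable def setRs (qφ : ℝ) (φ : ScalarField P j N) : Finset (HiggsLattice.Site P j) :=
  Finset.univ.filter fun x => qφ < absPhi φ x

variable (C : ChargeData N) (p qA qφ : ℝ) (ext : HiggsLattice.VecField P 0) (Abg : HiggsLattice.VecField P j)
  (B : HiggsLattice.VecField P (j + 1)) (A : HiggsLattice.VecField P j) (ψ : ScalarField P (j + 1) N) (φ : ScalarField P j N)

/-- `y ∈ P_v ↔ |B(y) − (QA)(y)| > p`. [cite: Balaban1982Higgs2, (2.4) p.557] -/
theorem mem_setPv {y : HiggsLattice.Site P (j + 1)} : y ∈ setPv p B A ↔ p < devB B A y := by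
  unfold setPv; simp only [Finset.mem_filter, Finset.mem_univ, true_and]

/-- `b ∈ Q_v ↔ |(∂A)(b)| > p`. [cite: Balaban1982Higgs2, (2.4) p.557] -/
theorem mem_setQv {b : HiggsLattice.PBond P j} : b ∈ setQv p A ↔ p < dA A b := by
  unfold setQv; simp only [Finset.mem_filter, Finset.mem_univ, true_and]

/-- `x ∈ R_v ↔ |A(x)| > qA`. [cite: Balaban1982Higgs2, (2.4) p.557] -/
theorem mem_setRv {x : HiggsLattice.Site P j} : x ∈ setRv qA A ↔ qA < absA A x := by
  unfold setRv; simp only [Finset.mem_filter, Finset.mem_univ, true_and]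

/-- `y ∈ P_s ↔ |ψ(y) − (Q(A)φ)(y)| > p`. [cite: Balaban1982Higgs2, (2.5) p.557] -/
theorem mem_setPs {y : HiggsLattice.Site P (j + 1)} : y ∈ setPs C p ext ψ φ ↔ p < devPsi C ext ψ φ y := by
  unfold setPs; simp only [Finset.mem_filter, Finset.mem_univ, true_and]

/-- `b ∈ Q_s ↔ |(D_Aφ)(b)| > p`. [cite: Balaban1982Higgs2, (2.5) p.557] -/
theorem mem_setQs {b : HiggsLattice.PBond P j} : b ∈ setQs C p Abg φ ↔ p < ‖covDeriv C Abg φ b‖ := by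
  unfold setQs; simp only [Finset.mem_filter, Finset.mem_univ, true_and]

/-- `x ∈ R_s ↔ |φ(x)| > qφ`. [cite: Balaban1982Higgs2, (2.5) p.557] -/
theorem mem_setRs {x : HiggsLattice.Site P j} : x ∈ setRs qφ φ ↔ qφ < absPhi φ x := by
  unfold setRs; simp only [Finset.mem_filter, Finset.mem_univ, true_and]

end Quantities

/-! ## §2 The expansions (2.4)/(2.5) at the concrete indicators, and the unique non-zero term -/

section Expansion

/-- Generic location lemma: for an event `E` on a finite type and a subset `S`,
`Π_{y∈S} χ({E y}) · Π_{y∉S} χ({¬E y}) = 1` if `S` is exactly the set where `E` holds, and `= 0` otherwise (*"We assign a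
division of the lattice … with each term"*). [cite: Balaban1982Higgs2, (2.6) p.558] -/
theorem prod_ind_eq_ite {ι : Type*} [Fintype ι] [DecidableEq ι] (E : ι → Prop) [DecidablePred E] (S : Finset ι) :
    (∏ y ∈ S, ind (E y)) * ∏ y ∈ Finset.univ \ S, ind (¬E y) =
      if S = Finset.univ.filter E then 1 else 0 := by
  split_ifs with hS
  · subst hS
    rw [Finset.prod_eq_one, Finset.prod_eq_one, one_mul]
    · intro y hy
      rw [Finset.mem_sdiff, Finset.mem_filter] at hy
      exact ind_of_pos fun h => hy.2 ⟨Finset.mem_univ y, h⟩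
    · intro y hy
      exact ind_of_pos (Finset.mem_filter.mp hy).2
  · -- some point witnesses the mismatch
    have : ∃ y, ¬ (y ∈ S ↔ E y) := by
      by_contra hcon
      refine hS (Finset.ext fun y => ?_)
      have hy : (y ∈ S ↔ E y) := not_not.mp (not_exists.mp hcon y)
      rw [Finset.mem_filter]
      exact ⟨fun h => ⟨Finset.mem_univ y, hy.mp h⟩, fun h => hy.mpr h.2⟩
    obtain ⟨y, hy⟩ := this
    by_cases hyS : y ∈ S
    · have hE : ¬E y := fun h => hy ⟨fun _ => h, fun _ => hyS⟩
      rw [Finset.prod_eq_zero hyS (ind_of_neg hE), zero_mul]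
    · have hE : E y := by
        by_contra h
        exact hy ⟨fun h' => absurd h' hyS, fun h' => absurd h' h⟩
      rw [Finset.prod_eq_zero (Finset.mem_sdiff.mpr ⟨Finset.mem_univ y, hyS⟩) (ind_of_neg (not_not_intro hE)), mul_zero]

variable (C : ChargeData N) (p qA qφ : ℝ) (ext : HiggsLattice.VecField P 0) (Abg : HiggsLattice.VecField P j)
  (B : HiggsLattice.VecField P (j + 1)) (A : HiggsLattice.VecField P j) (ψ : ScalarField P (j + 1) N) (φ : ScalarField P j N)

open Classical in
/-- **The term of (2.4)** indexed by `(P_v, Q_v, R_v)`: `χᶜ_{P_v}χ_{P_vᶜ}χᶜ_{Q_v}χ_{Q_vᶜ}χᶜ_{R_v}χ_{R_vᶜ}` at the configuration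
`(B, A)` (`χᶜ` = the large-field indicators, `χ` = the small-field ones, as printed). [cite: Balaban1982Higgs2, (2.4) p.557] -/
noncomputable def term24 (Pv : Finset (HiggsLattice.Site P (j + 1))) (Qv : Finset (HiggsLattice.PBond P j))
    (Rv : Finset (HiggsLattice.Site P j)) : ℝ :=
  ((∏ y ∈ Pv, ind (p < devB B A y)) * ∏ y ∈ Finset.univ \ Pv, ind (¬(p < devB B A y))) *
    (((∏ b ∈ Qv, ind (p < dA A b)) * ∏ b ∈ Finset.univ \ Qv, ind (¬(p < dA A b))) *
      ((∏ x ∈ Rv, ind (qA < absA A x)) * ∏ x ∈ Finset.univ \ Rv, ind (¬(qA < absA A x))))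

open Classical in
/-- **The term of (2.5)** indexed by `(P_s, Q_s, R_s)` at the configuration `(ψ, φ)` (transport field `ext`, covariant field `Abg`).
[cite: Balaban1982Higgs2, (2.5) p.557] -/
noncomputable def term25 (Ps : Finset (HiggsLattice.Site P (j + 1))) (Qs : Finset (HiggsLattice.PBond P j))
    (Rs : Finset (HiggsLattice.Site P j)) : ℝ :=
  ((∏ y ∈ Ps, ind (p < devPsi C ext ψ φ y)) * ∏ y ∈ Finset.univ \ Ps, ind (¬(p < devPsi C ext ψ φ y))) *
    (((∏ b ∈ Qs, ind (p < ‖covDeriv C Abg φ b‖)) * ∏ b ∈ Finset.univ \ Qs, ind (¬(p < ‖covDeriv C Abg φ b‖))) *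
      ((∏ x ∈ Rs, ind (qφ < absPhi φ x)) * ∏ x ∈ Finset.univ \ Rs, ind (¬(qφ < absPhi φ x))))

open Classical in
/-- The printed small-field factor `χ({… ≦ p(ε)})` is the indicator of the negated large-field event. [cite: Balaban1982Higgs2, (2.4) p.557] -/
theorem ind_not_lt (a t : ℝ) : ind (¬(t < a)) = ind (a ≤ t) := by
  unfold ind
  simp only [not_lt]

open Classical in
/-- **(2.4) ON THE CONCRETE CARRIER**: for every configuration `(B, A)` and all thresholds,
`Σ_{P_v⊂T′} Σ_{Q_v⊂T*} Σ_{R_v⊂T} χᶜ_{P_v}χ_{P_vᶜ}χᶜ_{Q_v}χ_{Q_vᶜ}χᶜ_{R_v}χ_{R_vᶜ} = 1` (r14's `partition24` at the concrete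
indicators). [cite: Balaban1982Higgs2, (2.4) p.557] -/
theorem eq24_concrete :
    ∑ Pv ∈ (Finset.univ : Finset (HiggsLattice.Site P (j + 1))).powerset,
      ∑ Qv ∈ (Finset.univ : Finset (HiggsLattice.PBond P j)).powerset,
        ∑ Rv ∈ (Finset.univ : Finset (HiggsLattice.Site P j)).powerset, term24 p qA B A Pv Qv Rv = 1 := by
  unfold term24
  have h := partition24 (R := ℝ) (Finset.univ : Finset (HiggsLattice.Site P (j + 1)))
    (Finset.univ : Finset (HiggsLattice.PBond P j)) (Finset.univ : Finset (HiggsLattice.Site P j))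
    (fun y => ind (p < devB B A y)) (fun y => ind (¬(p < devB B A y)))
    (fun b => ind (p < dA A b)) (fun b => ind (¬(p < dA A b)))
    (fun x => ind (qA < absA A x)) (fun x => ind (¬(qA < absA A x)))
    (fun y _ => ind_add_ind_not _) (fun b _ => ind_add_ind_not _) (fun x _ => ind_add_ind_not _)
  simpa [mul_assoc] using h

open Classical in
/-- **(2.5) ON THE CONCRETE CARRIER**: the scalar-field expansion sums to `1` for every configuration. [cite: Balaban1982Higgs2, (2.5) p.557] -/
theorem eq25_concrete :
    ∑ Ps ∈ (Finset.univ : Finset (HiggsLattice.Site P (j + 1))).powerset,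
      ∑ Qs ∈ (Finset.univ : Finset (HiggsLattice.PBond P j)).powerset,
        ∑ Rs ∈ (Finset.univ : Finset (HiggsLattice.Site P j)).powerset, term25 C p qφ ext Abg ψ φ Ps Qs Rs = 1 := by
  unfold term25
  have h := partition24 (R := ℝ) (Finset.univ : Finset (HiggsLattice.Site P (j + 1)))
    (Finset.univ : Finset (HiggsLattice.PBond P j)) (Finset.univ : Finset (HiggsLattice.Site P j))
    (fun y => ind (p < devPsi C ext ψ φ y)) (fun y => ind (¬(p < devPsi C ext ψ φ y)))
    (fun b => ind (p < ‖covDeriv C Abg φ b‖)) (fun b => ind (¬(p < ‖covDeriv C Abg φ b‖)))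
    (fun x => ind (qφ < absPhi φ x)) (fun x => ind (¬(qφ < absPhi φ x)))
    (fun y _ => ind_add_ind_not _) (fun b _ => ind_add_ind_not _) (fun x _ => ind_add_ind_not _)
  simpa [mul_assoc] using h

open Classical in
/-- **The term of (2.4) is `1` at the configuration's own large-field sets and `0` at every other triple** (*"We assign a
division of the lattice T₁ into two domains with each term in the above sum"*). [cite: Balaban1982Higgs2, (2.6) p.558] -/
theorem term24_eq_ite (Pv : Finset (HiggsLattice.Site P (j + 1))) (Qv : Finset (HiggsLattice.PBond P j))
    (Rv : Finset (HiggsLattice.Site P j)) :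
    term24 p qA B A Pv Qv Rv =
      if Pv = setPv p B A ∧ Qv = setQv p A ∧ Rv = setRv qA A then 1 else 0 := by
  unfold term24
  rw [prod_ind_eq_ite (fun y => p < devB B A y) Pv, prod_ind_eq_ite (fun b => p < dA A b) Qv,
    prod_ind_eq_ite (fun x => qA < absA A x) Rv]
  unfold setPv setQv setRv
  split_ifs <;> simp_all

open Classical in
/-- At the configuration's own sets the term of (2.4) equals `1`. [cite: Balaban1982Higgs2, (2.6) p.558] -/
theorem term24_self : term24 p qA B A (setPv p B A) (setQv p A) (setRv qA A) = 1 := by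
  rw [term24_eq_ite, if_pos ⟨rfl, rfl, rfl⟩]

open Classical in
/-- Any other triple gives `0`. [cite: Balaban1982Higgs2, (2.6) p.558] -/
theorem term24_eq_zero {Pv : Finset (HiggsLattice.Site P (j + 1))} {Qv : Finset (HiggsLattice.PBond P j)}
    {Rv : Finset (HiggsLattice.Site P j)} (h : ¬(Pv = setPv p B A ∧ Qv = setQv p A ∧ Rv = setRv qA A)) :
    term24 p qA B A Pv Qv Rv = 0 := by
  rw [term24_eq_ite, if_neg h]

open Classical in
/-- **The term of (2.5) is `1` at the configuration's own scalar large-field sets and `0` elsewhere.** [cite: Balaban1982Higgs2, (2.6) p.558] -/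
theorem term25_eq_ite (Ps : Finset (HiggsLattice.Site P (j + 1))) (Qs : Finset (HiggsLattice.PBond P j))
    (Rs : Finset (HiggsLattice.Site P j)) :
    term25 C p qφ ext Abg ψ φ Ps Qs Rs =
      if Ps = setPs C p ext ψ φ ∧ Qs = setQs C p Abg φ ∧ Rs = setRs qφ φ then 1 else 0 := by
  unfold term25
  rw [prod_ind_eq_ite (fun y => p < devPsi C ext ψ φ y) Ps, prod_ind_eq_ite (fun b => p < ‖covDeriv C Abg φ b‖) Qs,
    prod_ind_eq_ite (fun x => qφ < absPhi φ x) Rs]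
  unfold setPs setQs setRs
  split_ifs <;> simp_all

open Classical in
/-- At the configuration's own scalar sets the term of (2.5) equals `1`. [cite: Balaban1982Higgs2, (2.6) p.558] -/
theorem term25_self : term25 C p qφ ext Abg ψ φ (setPs C p ext ψ φ) (setQs C p Abg φ) (setRs qφ φ) = 1 := by
  rw [term25_eq_ite, if_pos ⟨rfl, rfl, rfl⟩]

end Expansion

/-! ## §3 *"all the fields are small on the set Λ₀ and on the neighbourhood of Λ₀ of the additional thickness r(ε)"* — for the fields -/

section SmallOnRegion

variable (C : ChargeData N) (p qA qφ : ℝ) (ext : HiggsLattice.VecField P 0) (Abg : HiggsLattice.VecField P j)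
  (B : HiggsLattice.VecField P (j + 1)) (A : HiggsLattice.VecField P j) (ψ : ScalarField P (j + 1) N) (φ : ScalarField P j N)

/-- **The large-field POINTS of a configuration**: the lattice points of `B(P_v) ∪ Q_v ∪ R_v ∪ B(P_s) ∪ Q_s ∪ R_s` (the typer's
`B2Eq28RegionsConcrete.badSites` at the configuration's sets) — the data of the construction (2.7). [cite: Balaban1982Higgs2, (2.7) p.558] -/
noncomputable def bad24 : Finset (HiggsLattice.Site P j) :=
  badSites (setPv p B A) (setPs C p ext ψ φ) (setQv p A) (setQs C p Abg φ) (setRv qA A) (setRs qφ φ)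

/-- **`Λ₀` of the configuration**: the region (2.7) of `B2Eq28RegionsConcrete` built on `bad24` (threshold `r` ↤ `r(ε)` in lattice
units). [cite: Balaban1982Higgs2, (2.7) p.558] -/
noncomputable def lambda0 (r : ℝ) : Finset (HiggsLattice.Site P j) :=
  region (↑(bad24 C p qA qφ ext Abg B A ψ φ) : Set (HiggsLattice.Site P j)) r 0

variable {C p qA qφ ext Abg B A ψ φ} {r : ℝ}

/-- A point of the `r`-neighbourhood of `Λ₀` is not a large-field point. [cite: Balaban1982Higgs2, (2.8) p.558] -/
theorem not_mem_bad24_of_mem_near (hr : 0 ≤ r) {x : HiggsLattice.Site P j}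
    (hx : x ∈ near (lambda0 C p qA qφ ext Abg B A ψ φ r) r) : x ∉ bad24 C p qA qφ ext Abg B A ψ φ := fun h =>
  not_bad_of_mem_near_region_zero hr hx (Finset.mem_coe.mpr h)

/-- **`|A(x)| ≤ (1/(μ₀ε))p(ε)` on the `r(ε)`-neighbourhood of `Λ₀`.** [cite: Balaban1982Higgs2, (2.8) p.558] -/
theorem absA_le_of_mem_near (hr : 0 ≤ r) {x : HiggsLattice.Site P j}
    (hx : x ∈ near (lambda0 C p qA qφ ext Abg B A ψ φ r) r) : absA A x ≤ qA := by
  by_contra h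
  exact not_mem_bad24_of_mem_near hr hx
    (mem_badSites_of_mem_v _ _ _ _ _ _ ((mem_setRv qA A).mpr (not_le.mp h)))

/-- **`|φ(x)| ≤ p(ε)/λ(ε)^{1/4}` on the `r(ε)`-neighbourhood of `Λ₀`.** [cite: Balaban1982Higgs2, (2.8) p.558] -/
theorem absPhi_le_of_mem_near (hr : 0 ≤ r) {x : HiggsLattice.Site P j}
    (hx : x ∈ near (lambda0 C p qA qφ ext Abg B A ψ φ r) r) : absPhi φ x ≤ qφ := by
  by_contra h
  exact not_mem_bad24_of_mem_near hr hx
    (mem_badSites_of_mem_s _ _ _ _ _ _ ((mem_setRs qφ φ).mpr (not_le.mp h)))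

/-- **`|(∂A)(b)| ≤ p(ε)` for every bond whose initial point lies in the `r(ε)`-neighbourhood of `Λ₀`.** [cite: Balaban1982Higgs2, (2.8) p.558] -/
theorem dA_le_of_src_mem_near (hr : 0 ≤ r) {b : HiggsLattice.PBond P j}
    (hb : b.src ∈ near (lambda0 C p qA qφ ext Abg B A ψ φ r) r) : dA A b ≤ p := by
  by_contra h
  exact not_mem_bad24_of_mem_near hr hb
    (src_mem_badSites_v _ _ _ _ _ _ ((mem_setQv p A).mpr (not_le.mp h)))

/-- The same for the final point. [cite: Balaban1982Higgs2, (2.8) p.558] -/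
theorem dA_le_of_tgt_mem_near (hr : 0 ≤ r) {b : HiggsLattice.PBond P j}
    (hb : b.tgt ∈ near (lambda0 C p qA qφ ext Abg B A ψ φ r) r) : dA A b ≤ p := by
  by_contra h
  exact not_mem_bad24_of_mem_near hr hb
    (tgt_mem_badSites_v _ _ _ _ _ _ ((mem_setQv p A).mpr (not_le.mp h)))

/-- **`|(D_Aφ)(b)| ≤ p(ε)` for every bond whose initial point lies in the `r(ε)`-neighbourhood of `Λ₀`.** [cite: Balaban1982Higgs2, (2.8) p.558] -/
theorem covDeriv_le_of_src_mem_near (hr : 0 ≤ r) {b : HiggsLattice.PBond P j}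
    (hb : b.src ∈ near (lambda0 C p qA qφ ext Abg B A ψ φ r) r) : ‖covDeriv C Abg φ b‖ ≤ p := by
  by_contra h
  exact not_mem_bad24_of_mem_near hr hb
    (src_mem_badSites_s _ _ _ _ _ _ ((mem_setQs C p Abg φ).mpr (not_le.mp h)))

/-- The same for the final point. [cite: Balaban1982Higgs2, (2.8) p.558] -/
theorem covDeriv_le_of_tgt_mem_near (hr : 0 ≤ r) {b : HiggsLattice.PBond P j}
    (hb : b.tgt ∈ near (lambda0 C p qA qφ ext Abg B A ψ φ r) r) : ‖covDeriv C Abg φ b‖ ≤ p := by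
  by_contra h
  exact not_mem_bad24_of_mem_near hr hb
    (tgt_mem_badSites_s _ _ _ _ _ _ ((mem_setQs C p Abg φ).mpr (not_le.mp h)))

/-- **`|B(y) − (QA)(y)| ≤ p(ε)` for the block `y = y(x)` of every point `x` of the `r(ε)`-neighbourhood of `Λ₀`.**
[cite: Balaban1982Higgs2, (2.8) p.558] -/
theorem devB_le_of_mem_near (hr : 0 ≤ r) {x : HiggsLattice.Site P j}
    (hx : x ∈ near (lambda0 C p qA qφ ext Abg B A ψ φ r) r) : devB B A (HiggsLattice.blockOf x) ≤ p := by
  by_contra h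
  exact not_mem_bad24_of_mem_near hr hx
    (mem_badSites_of_blockOf_mem_v _ _ _ _ _ _ ((mem_setPv p B A).mpr (not_le.mp h)))

/-- **`|ψ(y) − (Q(A)φ)(y)| ≤ p(ε)` for the block of every point of the `r(ε)`-neighbourhood of `Λ₀`.** [cite: Balaban1982Higgs2, (2.8) p.558] -/
theorem devPsi_le_of_mem_near (hr : 0 ≤ r) {x : HiggsLattice.Site P j}
    (hx : x ∈ near (lambda0 C p qA qφ ext Abg B A ψ φ r) r) : devPsi C ext ψ φ (HiggsLattice.blockOf x) ≤ p := by
  by_contra h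
  exact not_mem_bad24_of_mem_near hr hx
    (mem_badSites_of_blockOf_mem_s _ _ _ _ _ _ ((mem_setPs C p ext ψ φ).mpr (not_le.mp h)))

/-- **p. 558, the sentence, as r14's six-number predicate**: at every point `x` of the `r(ε)`-neighbourhood of `Λ₀` and every
bond `b` starting at `x`, `SmallField μ₀ λ ε d p(ε) (|B(y(x))−(QA)(y(x))|) (|(∂A)(b)|) (|A(x)|) (|ψ(y(x))−(Q(A)φ)(y(x))|) (|(D_Aφ)(b)|)
(|φ(x)|)` with the printed thresholds `qA = thrA μ₀ ε p(ε)`, `qφ = thrPhi λ ε d p(ε)`. [cite: Balaban1982Higgs2, (2.8) p.558] -/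
theorem smallField_of_mem_near {μ₀ lam ε : ℝ} (hr : 0 ≤ r) {x : HiggsLattice.Site P j} {b : HiggsLattice.PBond P j}
    (hx : x ∈ near (lambda0 C p (thrA μ₀ ε p) (thrPhi lam ε P.d p) ext Abg B A ψ φ r) r) (hb : b.src = x) :
    SmallField μ₀ lam ε P.d p (devB B A (HiggsLattice.blockOf x)) (dA A b) (absA A x)
      (devPsi C ext ψ φ (HiggsLattice.blockOf x)) ‖covDeriv C Abg φ b‖ (absPhi φ x) := by
  subst hb
  exact ⟨devB_le_of_mem_near hr hx, dA_le_of_src_mem_near hr hx, absA_le_of_mem_near hr hx,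
    devPsi_le_of_mem_near hr hx, covDeriv_le_of_src_mem_near hr hx, absPhi_le_of_mem_near hr hx⟩

/-- On `Λ₀` itself (`r > 0`, `Λ₀ ⊂` its own neighbourhood): all six field quantities are small. [cite: Balaban1982Higgs2, (2.8) p.558] -/
theorem smallField_of_mem_lambda0 {μ₀ lam ε : ℝ} (hr : 0 < r) {x : HiggsLattice.Site P j} {b : HiggsLattice.PBond P j}
    (hx : x ∈ lambda0 C p (thrA μ₀ ε p) (thrPhi lam ε P.d p) ext Abg B A ψ φ r) (hb : b.src = x) :
    SmallField μ₀ lam ε P.d p (devB B A (HiggsLattice.blockOf x)) (dA A b) (absA A x)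
      (devPsi C ext ψ φ (HiggsLattice.blockOf x)) ‖covDeriv C Abg φ b‖ (absPhi φ x) :=
  smallField_of_mem_near hr.le (subset_near hr hx) hb

/-- Equivalently, NO large-field event of (2.2) occurs there (r14's `LargeField` negated). [cite: Balaban1982Higgs2, (2.2) p.557] -/
theorem not_largeField_of_mem_near {μ₀ lam ε : ℝ} (hr : 0 ≤ r) {x : HiggsLattice.Site P j} {b : HiggsLattice.PBond P j}
    (hx : x ∈ near (lambda0 C p (thrA μ₀ ε p) (thrPhi lam ε P.d p) ext Abg B A ψ φ r) r) (hb : b.src = x) :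
    ¬ LargeField μ₀ lam ε P.d p (devB B A (HiggsLattice.blockOf x)) (dA A b) (absA A x)
      (devPsi C ext ψ φ (HiggsLattice.blockOf x)) ‖covDeriv C Abg φ b‖ (absPhi φ x) :=
  (smallField_iff_not_largeField _ _ _ _ _ _ _ _ _ _ _).mp (smallField_of_mem_near hr hx hb)

/-- The large-field points are the union of the six printed contributions; in particular every point of `R_v` is one.
[cite: Balaban1982Higgs2, (2.7) p.558] -/
theorem mem_bad24_of_mem_setRv {x : HiggsLattice.Site P j} (hx : x ∈ setRv qA A) : x ∈ bad24 C p qA qφ ext Abg B A ψ φ :=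
  mem_badSites_of_mem_v _ _ _ _ _ _ hx

/-- Hence the large-field points lie outside `Λ₀` (`r > 0`). [cite: Balaban1982Higgs2, (2.7) p.558] -/
theorem not_mem_lambda0_of_mem_bad24 (hr : 0 < r) {x : HiggsLattice.Site P j} (hx : x ∈ bad24 C p qA qφ ext Abg B A ψ φ) :
    x ∉ lambda0 C p qA qφ ext Abg B A ψ φ r :=
  not_mem_region_of_bad hr 0 (Finset.mem_coe.mpr hx)

/-- With no large-field point at all (the whole configuration small), `Λ₀` is the whole torus. [cite: Balaban1982Higgs2, (2.7) p.558] -/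
theorem lambda0_eq_univ_of_bad24_empty (h : bad24 C p qA qφ ext Abg B A ψ φ = ∅) (r : ℝ) :
    lambda0 C p qA qφ ext Abg B A ψ φ r = Finset.univ := by
  unfold lambda0
  rw [h, Finset.coe_empty]
  exact region_eq_univ_of_bad_empty r 0

end SmallOnRegion

/-! ## §4 (v1.1) Measurability: the terms of (2.4)/(2.5) are measurable functions of the configuration

p. 558: *"The above expansion is introduced under the integral (2.1) and we get a sum of terms."* — for this the indicator
products must be measurable in the fields.  The six quantities of (2.2) are CONTINUOUS in the configuration (finite-dimensional
linear algebra: `B1Eq31Concrete.continuous_toSite`, `HiggsDoubleRT.continuous_avgQ_comp`, `HiggsActionIntegrable.continuous_covDeriv`),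
so the large-field events are measurable sets and every term of (2.4)/(2.5) is a measurable function (values in `{0,1}`). -/

section Measurability

open MeasureTheory
open B1Eq31Concrete (continuous_toSite)
open HiggsDoubleRT (continuous_avgQ_comp)
open HiggsActionIntegrable (continuous_covDeriv)

/-- `(B, A) ↦ |B(y) − (QA)(y)|` is continuous. [cite: Balaban1982Higgs2, (2.2) p.557] -/
theorem continuous_devB (y : HiggsLattice.Site P (j + 1)) :
    Continuous fun q : HiggsLattice.VecField P (j + 1) × HiggsLattice.VecField P j => devB q.1 q.2 y := by
  unfold devB
  have h1 : Continuous fun q : HiggsLattice.VecField P (j + 1) × HiggsLattice.VecField P j => toSite q.1 y :=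
    (continuous_apply y).comp (continuous_toSite.comp continuous_fst)
  have h2 : Continuous fun q : HiggsLattice.VecField P (j + 1) × HiggsLattice.VecField P j =>
      avgQ (zeroCharge P.d) (0 : HiggsLattice.VecField P 0) (toSite q.2) y :=
    (continuous_apply y).comp
      (continuous_avgQ_comp (zeroCharge P.d) continuous_const (continuous_toSite.comp continuous_snd))
  exact (h1.sub h2).norm

/-- `(ψ, φ) ↦ |ψ(y) − (Q(A)φ)(y)|` is continuous (fixed transport field). [cite: Balaban1982Higgs2, (2.2) p.557] -/
theorem continuous_devPsi (C : ChargeData N) (ext : HiggsLattice.VecField P 0) (y : HiggsLattice.Site P (j + 1)) :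
    Continuous fun q : ScalarField P (j + 1) N × ScalarField P j N => devPsi C ext q.1 q.2 y := by
  unfold devPsi
  have h1 : Continuous fun q : ScalarField P (j + 1) N × ScalarField P j N => q.1 y :=
    (continuous_apply y).comp continuous_fst
  have h2 : Continuous fun q : ScalarField P (j + 1) N × ScalarField P j N => avgQ C ext q.2 y :=
    (continuous_apply y).comp (continuous_avgQ_comp C continuous_const continuous_snd)
  exact (h1.sub h2).norm

/-- `A ↦ |(∂A)(b)|` is continuous. [cite: Balaban1982Higgs2, (2.2) p.557] -/
theorem continuous_dA (b : HiggsLattice.PBond P j) : Continuous fun A : HiggsLattice.VecField P j => dA A b := by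
  have h : Continuous fun A : HiggsLattice.VecField P j => HiggsLattice.sderiv (toSite A) b := by
    unfold HiggsLattice.sderiv
    exact (((continuous_apply b.tgt).comp continuous_toSite).sub
      ((continuous_apply b.src).comp continuous_toSite)).const_smul ((P.mesh j)⁻¹ : ℝ)
  simpa only [B2Eq255Concrete.dA_eq] using h.norm

/-- `A ↦ |A(x)|` is continuous. [cite: Balaban1982Higgs2, (2.2) p.557] -/
theorem continuous_absA (x : HiggsLattice.Site P j) : Continuous fun A : HiggsLattice.VecField P j => absA A x :=
  ((continuous_apply x).comp continuous_toSite).norm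

/-- `(A, φ) ↦ |(D_Aφ)(b)|` is continuous. [cite: Balaban1982Higgs2, (2.2) p.557] -/
theorem continuous_norm_covDeriv (C : ChargeData N) (b : HiggsLattice.PBond P j) :
    Continuous fun q : HiggsLattice.VecField P j × ScalarField P j N => ‖covDeriv C q.1 q.2 b‖ :=
  (continuous_covDeriv C b).norm

/-- `φ ↦ |φ(x)|` is continuous. [cite: Balaban1982Higgs2, (2.2) p.557] -/
theorem continuous_absPhi (x : HiggsLattice.Site P j) : Continuous fun φ : ScalarField P j N => absPhi φ x :=
  (continuous_apply x).norm

/-- Generic measurability of one factor group of (2.4)/(2.5): for events `E x i` with measurable level sets,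
`x ↦ Π_{i∈S} χ({E x i}) · Π_{i∉S} χ({¬E x i})` is measurable. [cite: Balaban1982Higgs2, (2.6) p.558] -/
theorem measurable_prodInd {X ι : Type*} [MeasurableSpace X] [Fintype ι] [DecidableEq ι] (E : X → ι → Prop)
    [∀ x i, Decidable (E x i)] (hE : ∀ i, MeasurableSet {x | E x i}) (S : Finset ι) :
    Measurable fun x => (∏ i ∈ S, ind (E x i)) * ∏ i ∈ Finset.univ \ S, ind (¬E x i) := by
  unfold ind
  refine Measurable.mul ?_ ?_
  · exact Finset.measurable_prod S fun i _ => Measurable.ite (hE i) measurable_const measurable_const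
  · exact Finset.measurable_prod _ fun i _ => Measurable.ite (hE i).compl measurable_const measurable_const

open Classical in
/-- **Every term of (2.4) is a measurable function of the configuration `(B, A)`** (so (2.4)/(2.6) may be introduced under the
integral (2.1), p. 558). [cite: Balaban1982Higgs2, (2.6) p.558] -/
theorem measurable_term24 (p qA : ℝ) (Pv : Finset (HiggsLattice.Site P (j + 1))) (Qv : Finset (HiggsLattice.PBond P j))
    (Rv : Finset (HiggsLattice.Site P j)) :
    Measurable fun q : HiggsLattice.VecField P (j + 1) × HiggsLattice.VecField P j => term24 p qA q.1 q.2 Pv Qv Rv := by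
  have h1 := measurable_prodInd
    (fun (q : HiggsLattice.VecField P (j + 1) × HiggsLattice.VecField P j) (y : HiggsLattice.Site P (j + 1)) =>
      p < devB q.1 q.2 y) (fun y => measurableSet_lt measurable_const (continuous_devB y).measurable) Pv
  have h2 := measurable_prodInd
    (fun (q : HiggsLattice.VecField P (j + 1) × HiggsLattice.VecField P j) (b : HiggsLattice.PBond P j) => p < dA q.2 b)
    (fun b => measurableSet_lt measurable_const ((continuous_dA b).comp continuous_snd).measurable) Qv
  have h3 := measurable_prodInd
    (fun (q : HiggsLattice.VecField P (j + 1) × HiggsLattice.VecField P j) (x : HiggsLattice.Site P j) => qA < absA q.2 x)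
    (fun x => measurableSet_lt measurable_const ((continuous_absA x).comp continuous_snd).measurable) Rv
  exact h1.mul (h2.mul h3)

open Classical in
/-- **Every term of (2.5) is a measurable function of the configuration `(A, ψ, φ)`** (transport field fixed, covariant-derivative
field = the variable `A`). [cite: Balaban1982Higgs2, (2.6) p.558] -/
theorem measurable_term25 (C : ChargeData N) (p qφ : ℝ) (ext : HiggsLattice.VecField P 0)
    (Ps : Finset (HiggsLattice.Site P (j + 1))) (Qs : Finset (HiggsLattice.PBond P j)) (Rs : Finset (HiggsLattice.Site P j)) :
    Measurable fun q : HiggsLattice.VecField P j × (ScalarField P (j + 1) N × ScalarField P j N) =>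
      term25 C p qφ ext q.1 q.2.1 q.2.2 Ps Qs Rs := by
  have h1 := measurable_prodInd
    (fun (q : HiggsLattice.VecField P j × (ScalarField P (j + 1) N × ScalarField P j N)) (y : HiggsLattice.Site P (j + 1)) =>
      p < devPsi C ext q.2.1 q.2.2 y)
    (fun y => measurableSet_lt measurable_const ((continuous_devPsi C ext y).comp continuous_snd).measurable) Ps
  have h2 := measurable_prodInd
    (fun (q : HiggsLattice.VecField P j × (ScalarField P (j + 1) N × ScalarField P j N)) (b : HiggsLattice.PBond P j) =>
      p < ‖covDeriv C q.1 q.2.2 b‖)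
    (fun b => measurableSet_lt measurable_const
      ((continuous_norm_covDeriv C b).comp (continuous_fst.prodMk (continuous_snd.comp continuous_snd))).measurable) Qs
  have h3 := measurable_prodInd
    (fun (q : HiggsLattice.VecField P j × (ScalarField P (j + 1) N × ScalarField P j N)) (x : HiggsLattice.Site P j) =>
      qφ < absPhi q.2.2 x)
    (fun x => measurableSet_lt measurable_const ((continuous_absPhi x).comp (continuous_snd.comp continuous_snd)).measurable) Rs
  exact h1.mul (h2.mul h3)

end Measurability

end Literature.MathematicalPhysics.QuantumFieldTheory.Balaban1983to89.B2Eq22LargeFieldSets
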